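import Mathlib

/-!
# Random sub-bath certificate for the Caldeira–Leggett star bath (DEQ-A76)

HONEST FRAMING: instance-level adjudication of specific advantage claims; no claim about
BQP vs BPP or the summit.

Context (cell pub-qadeq, claim A-76 = Villanyi, Yanay, Mizel, "Exponential Quantum Advantage for
Simulating Open Classical Systems", arXiv:2503.11483v1: the Problem on p. 2, equations of motion (5a)–(5d)
p. 7).  DEQ-A76.md (unit pub-qadeq-deq-1) shows that the Problem as printed — `d = poly(n)` primary
oscillators, one of which (`x_*`) is coupled to `N = 2ⁿ` bath modes started at their shifted equilibrium —
is solved classically by (i) the exact generalized-Langevin reduction (Zwanzig 2001 §1.6; Tuckerman 2023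
§15.2): the bath enters only through the memory kernel `K(τ) = Σ_α (g_α²/ν_α) cos(ν_α τ)`, and (ii) a RANDOM
SUB-BATH of `m = poly(t, 1/ε, Λ, log(1/δ))` sampled, re-weighted modes whose kernel `K̂` is `ε_K`-close to
`K` on `[0,t]`, after which a `(d+m)`-oscillator system is integrated exactly.  This file proves,
sorry-free, the real-analysis lemmas that carry the error certificate (Theorem A76 of DEQ-A76.md §4):

* `sqrt_le_of_deriv_le_mul_sqrt` — the ENERGY COMPARISON: if `0 ≤ E`, `E' ≤ 2 φ √E` on `(0,t)` with
  `φ = F' ≥ 0`, then `√(E t) ≤ √(E 0) + (F t − F 0)`.  Applied to the total energy `ℰ` of the error system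
  (driven by the kernel-defect force `f`, `dℰ/dt = f ė_* ≤ |f| √(2ℰ/m_*)`) with `φ = |f|/√(2 m_*)` it gives
  `√ℰ(t) ≤ (2 m_*)^{-1/2} ∫₀ᵗ |f|` (DEQ-A76 Lemma E);
* `abs_kernel_sub_le` — a finite cosine sum `Σ w_j cos(ν_j τ)` is Lipschitz in `τ` with constant
  `Σ |w_j| |ν_j|` (the net step of the kernel concentration, DEQ-A76 Lemma N);
* `abs_le_of_grid` — net-to-sup: `L`-Lipschitz + `|D| ≤ ε/2` on the grid `{k h}_{k ≤ n}` covering `[0,t]`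
  + `L h ≤ ε` ⇒ `|D| ≤ ε` on `[0,t]`;
* `union_hoeffding_budget` — the sample count: `m ≥ (8 C²/ε²) log(2 n/δ)` makes the Hoeffding–union
  bound `2 n exp(−m ε²/(8 C²))` at most `δ`;
* `amplitude_error_budget` — the constants of Theorem A76: kernel accuracy `ε_K = 2 m_* ε/t²` turns
  `√ℰ ≤ ε_K t² √E₀/(2 m_*)` into the relative amplitude (energy-norm) error `√ℰ ≤ ε √E₀`.

Everything is `[folklore]`-level real analysis / arithmetic over Mathlib; no named fact, no axiom, no `def`.
The probabilistic statement (Hoeffding's inequality itself) and the Hamiltonian bookkeeping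
(`dℰ/dt = f ė_*`) are NOT formalised here; they are proved on paper in DEQ-A76.md §4.
-/

namespace Summit.QuantumAdvantage.Dequantization.RandomSubBath

open Finset BigOperators Set

section EnergyComparison

/-- `[folklore]` **Energy comparison (DEQ-A76 Lemma E).** Let `E` be continuous on `[0,t]`, nonnegative,
with derivative `E'` on `(0,t)` satisfying `E' s ≤ 2 φ s √(E s)`, where `φ ≥ 0` is the derivative of a
continuous `F`.  Then `√(E t) ≤ √(E 0) + (F t − F 0)`.  (Proof: `s ↦ √(E s + η²) − F s` is antitone for
every `η > 0`; let `η → 0`.) -/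
theorem sqrt_le_of_deriv_le_mul_sqrt {E E' F φ : ℝ → ℝ} {t : ℝ} (ht : 0 ≤ t)
    (hEc : ContinuousOn E (Icc 0 t)) (hFc : ContinuousOn F (Icc 0 t))
    (hEd : ∀ s ∈ Ioo 0 t, HasDerivAt E (E' s) s) (hFd : ∀ s ∈ Ioo 0 t, HasDerivAt F (φ s) s)
    (hEnn : ∀ s ∈ Icc 0 t, 0 ≤ E s) (hφ : ∀ s ∈ Ioo 0 t, 0 ≤ φ s)
    (hineq : ∀ s ∈ Ioo 0 t, E' s ≤ 2 * φ s * Real.sqrt (E s)) :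
    Real.sqrt (E t) ≤ Real.sqrt (E 0) + (F t - F 0) := by
  have key : ∀ η : ℝ, 0 < η →
      Real.sqrt (E t + η ^ 2) - F t ≤ Real.sqrt (E 0 + η ^ 2) - F 0 := by
    intro η hη
    set G : ℝ → ℝ := fun s ↦ Real.sqrt (E s + η ^ 2) - F s with hGdef
    have hpos : ∀ s ∈ Icc 0 t, 0 < E s + η ^ 2 := fun s hs ↦ by
      have := hEnn s hs
      positivity
    have hGc : ContinuousOn G (Icc 0 t) := ((hEc.add continuousOn_const).sqrt).sub hFc
    have hGd : ∀ s ∈ Ioo 0 t,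
        HasDerivAt G (E' s / (2 * Real.sqrt (E s + η ^ 2)) - φ s) s := by
      intro s hs
      have h1 : HasDerivAt (fun s ↦ E s + η ^ 2) (E' s) s := by
        simpa using (hEd s hs).add_const (η ^ 2)
      exact (h1.sqrt (hpos s (Ioo_subset_Icc_self hs)).ne').sub (hFd s hs)
    have hanti : AntitoneOn G (Icc 0 t) := by
      refine antitoneOn_of_deriv_nonpos (convex_Icc 0 t) hGc ?_ ?_
      · rw [interior_Icc]
        exact fun s hs ↦ (hGd s hs).differentiableAt.differentiableWithinAt
      · rw [interior_Icc]
        intro s hs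
        rw [(hGd s hs).deriv]
        have hsI := Ioo_subset_Icc_self hs
        have hsq_pos : 0 < Real.sqrt (E s + η ^ 2) := Real.sqrt_pos.2 (hpos s hsI)
        have hmono : Real.sqrt (E s) ≤ Real.sqrt (E s + η ^ 2) :=
          Real.sqrt_le_sqrt (by nlinarith [sq_nonneg η])
        have hφs := hφ s hs
        have hE' : E' s ≤ 2 * φ s * Real.sqrt (E s + η ^ 2) :=
          (hineq s hs).trans (by nlinarith [hmono, hφs])
        have hdiv : E' s / (2 * Real.sqrt (E s + η ^ 2)) ≤ φ s := by
          rw [div_le_iff₀ (by positivity)]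
          linarith [hE']
        linarith
    have h := hanti (left_mem_Icc.2 ht) (right_mem_Icc.2 ht) ht
    simp only [hGdef] at h
    linarith
  refine le_of_forall_pos_le_add (fun ε hε ↦ ?_)
  have h1 : Real.sqrt (E t) ≤ Real.sqrt (E t + ε ^ 2) :=
    Real.sqrt_le_sqrt (by nlinarith [sq_nonneg ε])
  have hE0 : 0 ≤ E 0 := hEnn 0 (left_mem_Icc.2 ht)
  have hs0 : 0 ≤ Real.sqrt (E 0) := Real.sqrt_nonneg _
  have h2 : Real.sqrt (E 0 + ε ^ 2) ≤ Real.sqrt (E 0) + ε := by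
    calc Real.sqrt (E 0 + ε ^ 2) ≤ Real.sqrt ((Real.sqrt (E 0) + ε) ^ 2) := by
          apply Real.sqrt_le_sqrt
          nlinarith [Real.sq_sqrt hE0, hs0, hε.le]
      _ = Real.sqrt (E 0) + ε := Real.sqrt_sq (by positivity)
  have h3 := key ε hε
  linarith

end EnergyComparison

section KernelNet

/-- `[folklore]` **Lipschitz constant of a finite cosine sum (DEQ-A76 Lemma N, step 1).**
`|Σ_j w_j cos(ν_j τ) − Σ_j w_j cos(ν_j τ')| ≤ (Σ_j |w_j| |ν_j|) |τ − τ'|`. -/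
theorem abs_kernel_sub_le {ι : Type*} (s : Finset ι) (w ν : ι → ℝ) (τ τ' : ℝ) :
    |∑ j ∈ s, w j * Real.cos (ν j * τ) - ∑ j ∈ s, w j * Real.cos (ν j * τ')|
      ≤ (∑ j ∈ s, |w j| * |ν j|) * |τ - τ'| := by
  rw [← Finset.sum_sub_distrib, Finset.sum_mul]
  refine (Finset.abs_sum_le_sum_abs _ _).trans (Finset.sum_le_sum fun j _ ↦ ?_)
  have h := Real.abs_cos_sub_cos_le (ν j * τ) (ν j * τ')
  rw [← mul_sub, abs_mul] at h
  rw [← mul_sub, abs_mul]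
  calc |w j| * |Real.cos (ν j * τ) - Real.cos (ν j * τ')| ≤ |w j| * (|ν j| * |τ - τ'|) :=
        mul_le_mul_of_nonneg_left h (abs_nonneg _)
    _ = |w j| * |ν j| * |τ - τ'| := by ring

/-- `[folklore]` **Net-to-sup (DEQ-A76 Lemma N, step 2).** If `D` is `L`-Lipschitz, `|D (k h)| ≤ ε/2`
for every grid index `k ≤ n`, the grid covers `[0,t]` (`t ≤ n h`) and `L h ≤ ε`, then `|D x| ≤ ε` for all
`x ∈ [0,t]` (nearest grid point is within `h/2`). -/
theorem abs_le_of_grid {D : ℝ → ℝ} {L h ε t : ℝ} {n : ℕ} (hh : 0 < h) (hL : 0 ≤ L)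
    (hLip : ∀ x y : ℝ, |D x - D y| ≤ L * |x - y|)
    (hgrid : ∀ k : ℕ, k ≤ n → |D (k * h)| ≤ ε / 2)
    (hcover : t ≤ n * h) (hLh : L * h ≤ ε) :
    ∀ x ∈ Icc 0 t, |D x| ≤ ε := by
  intro x hx
  obtain ⟨hx0, hxt⟩ := hx
  have hq0 : 0 ≤ x / h := div_nonneg hx0 hh.le
  have hqn : x / h ≤ n := by
    rw [div_le_iff₀ hh]
    exact hxt.trans hcover
  set k₀ : ℕ := ⌊x / h⌋₊ with hk₀
  have hfl : (k₀ : ℝ) ≤ x / h := Nat.floor_le hq0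
  have hlt : x / h < k₀ + 1 := Nat.lt_floor_add_one (x / h)
  have hk₀n : k₀ ≤ n := by
    have : (k₀ : ℝ) ≤ n := hfl.trans hqn
    exact_mod_cast this
  -- choose the nearer of k₀, k₀ + 1
  have main : ∃ k : ℕ, k ≤ n ∧ |x - k * h| ≤ h / 2 := by
    by_cases hc : x / h - k₀ ≤ 1 / 2
    · refine ⟨k₀, hk₀n, ?_⟩
      have e1 : x - k₀ * h = (x / h - k₀) * h := by field_simp
      rw [e1, abs_mul, abs_of_pos hh, abs_of_nonneg (by linarith)]
      nlinarith
    · push Not at hc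
      have hk1n : k₀ + 1 ≤ n := by
        by_contra hcon
        push Not at hcon
        have : n ≤ k₀ := by omega
        have : (n : ℝ) ≤ k₀ := by exact_mod_cast this
        linarith
      refine ⟨k₀ + 1, hk1n, ?_⟩
      have e1 : x - ((k₀ + 1 : ℕ) : ℝ) * h = (x / h - (k₀ + 1)) * h := by
        push_cast
        field_simp
      rw [e1, abs_mul, abs_of_pos hh, abs_of_nonpos (by linarith)]
      nlinarith
  obtain ⟨k, hkn, hdist⟩ := main
  have h1 := hLip x (k * h)
  have h2 := hgrid k hkn
  have h3 : L * |x - k * h| ≤ L * (h / 2) := mul_le_mul_of_nonneg_left hdist hL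
  have h4 : |D x| - |D (k * h)| ≤ |D x - D (k * h)| := abs_sub_abs_le_abs_sub (D x) (D (k * h))
  linarith

end KernelNet

section Budgets

/-- `[folklore]` **Sample count (DEQ-A76 Theorem A76, probabilistic step).** With
`m ≥ (8 C²/ε²) · log(2 n/δ)` samples the Hoeffding–union bound over `n` net points,
`2 n · exp(−m ε²/(8 C²))`, is at most `δ`. -/
theorem union_hoeffding_budget {C ε δ m : ℝ} {n : ℕ} (hC : 0 < C) (hε : 0 < ε) (hδ : 0 < δ)
    (hn : 0 < n) (hm : 8 * C ^ 2 / ε ^ 2 * Real.log (2 * n / δ) ≤ m) :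
    2 * n * Real.exp (-(m * ε ^ 2 / (8 * C ^ 2))) ≤ δ := by
  have hn' : (0 : ℝ) < n := by exact_mod_cast hn
  have hpos : (0 : ℝ) < 2 * n / δ := by positivity
  have h1 : Real.log (2 * n / δ) ≤ m * ε ^ 2 / (8 * C ^ 2) := by
    rw [le_div_iff₀ (by positivity)]
    have hmul := mul_le_mul_of_nonneg_right hm (le_of_lt (by positivity : (0 : ℝ) < ε ^ 2))
    have e : 8 * C ^ 2 / ε ^ 2 * Real.log (2 * n / δ) * ε ^ 2 = Real.log (2 * n / δ) * (8 * C ^ 2) := by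
      field_simp
    linarith [hmul, e]
  calc 2 * n * Real.exp (-(m * ε ^ 2 / (8 * C ^ 2)))
      ≤ 2 * n * Real.exp (-Real.log (2 * n / δ)) := by
        gcongr
    _ = δ := by
        rw [Real.exp_neg, Real.exp_log hpos]
        field_simp

/-- `[folklore]` **Constants of Theorem A76.** Kernel accuracy `ε_K = 2 m_* ε / t²` turns the energy
estimate `√ℰ ≤ ε_K t² √E₀ /(2 m_*)` (Lemma E with `∫₀ᵗ |f| ≤ ε_K t² √(2 E₀/m_*)/2`) into the relative
amplitude-vector error `√ℰ ≤ ε √E₀`, i.e. `‖a_RSB(t) − a(t)‖₂ = √(ℰ_S/E₀) ≤ ε`. -/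
theorem amplitude_error_budget {ℰ E₀ εK ε t mstar : ℝ} (hm : 0 < mstar) (ht : 0 < t)
    (hE : Real.sqrt ℰ ≤ εK * t ^ 2 * Real.sqrt E₀ / (2 * mstar)) (hK : εK = 2 * mstar * ε / t ^ 2) :
    Real.sqrt ℰ ≤ ε * Real.sqrt E₀ := by
  subst hK
  have e : 2 * mstar * ε / t ^ 2 * t ^ 2 * Real.sqrt E₀ / (2 * mstar) = ε * Real.sqrt E₀ := by
    field_simp
  linarith [hE, e]

/-- `[folklore]` **Sample count is `N`-free.** The explicit sufficient sample size of Theorem A76,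
`m(Λ,t,ε,δ,n_net) = 2 Λ² t⁴ log(2 n_net/δ)/(m_*² ε²)`, equals the Hoeffding budget of
`union_hoeffding_budget` at kernel accuracy `ε_K = 2 m_* ε/t²` (pure rewriting; recorded so that the
document's two displayed formulas are checked to be the same number). -/
theorem sample_count_rewrite {Λ t ε δ mstar nnet : ℝ} (hm : 0 < mstar) (ht : 0 < t) (hε : 0 < ε) :
    8 * Λ ^ 2 / (2 * mstar * ε / t ^ 2) ^ 2 * Real.log (2 * nnet / δ)
      = 2 * Λ ^ 2 * t ^ 4 * Real.log (2 * nnet / δ) / (mstar ^ 2 * ε ^ 2) := by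
  field_simp
  ring

end Budgets

end Summit.QuantumAdvantage.Dequantization.RandomSubBath
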